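import Mathlib
import Literature.NumberTheory.LFunctions.LiouvilleSumClassicalBound
import HarnessLib

/-!
# Crux `MobiusLadder.LiouvilleOrthogonalTC0` (stmt-QuantumAdvantage-1393), line `Sketch`, skeleton v8:
stub `stub_sliceCriterion_of` (K3c) — the slice criterion

With `s₂(N)` the number of `1`-digits among the `n` low binary digits of `N`,
`A_j := ∑_{N < 2ⁿ, s₂(N) = j} λ(N)` the slice sums of the Liouville function and
`S(θ) := ∑_{N < 2ⁿ} λ(N) e(θ s₂(N))` the Gelfond sums: from the discrete Parseval bound
`∑_j A_j² ≤ (n+1)⁻¹ ∑_k |S(k/(n+1))|²` and the Hoeffding tail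
`#{N < 2ⁿ : t ≤ |s₂(N) − n/2|} ≤ 2·2ⁿ e^{−2t²/n}` we deduce: for every `ε > 0`, for all large `n`,
if all `|S(k/(n+1))| ≤ 2ⁿ/n` then `|∑_{N < 2ⁿ} λ(N) G(s₂(N))| ≤ ε 2ⁿ` for every `G` with `|G| ≤ 1`.

Proof: fibre decomposition `∑_N λ(N) G(s₂ N) = ∑_j G(j) A_j`, splitting `j` into a central window
`|j − n/2| < t` (at most `4t` values of `j`; Cauchy–Schwarz against `∑_j A_j² ≤ (2ⁿ/n)²`) and the
far range `t ≤ |j − n/2|` (bounded by the tail count), with `t = ⌈√(nL/2)⌉`, `e^{−L} ≤ ε/4`.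
The whole argument is carried out for an abstract weight `w` and an abstract `f` with `|f| ≤ 1`
(`sliceCrit_eventually`); `λ` only enters through `|λ(N)| ≤ 1`.
-/

set_option linter.dupNamespace false -- D-0017: single-problem summit ⇒ `QuantumAdvantage.QuantumAdvantage` by design

noncomputable section

namespace Summit.QuantumAdvantage.QuantumAdvantage.Theorems.LiouvilleOrthogonalTC0

open Filter Finset

/-- Fibre decomposition bound: regrouping `∑_x f(x) G(w x)` along the fibres of `w` (which maps
into `range m`), `|∑_x f(x) G(w x)| ≤ ∑_{j < m} |∑_{x : w x = j} f(x)| · |G(j)|`. -/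
theorem sliceCrit_abs_sum_mul_le {α : Type*} (s : Finset α) (w : α → ℕ) (f : α → ℝ)
    (G : ℕ → ℝ) {m : ℕ} (hw : ∀ x ∈ s, w x < m) :
    |∑ x ∈ s, f x * G (w x)|
      ≤ ∑ j ∈ Finset.range m, |∑ x ∈ s.filter (fun x => w x = j), f x| * |G j| := by
  have hmaps : ∀ x ∈ s, w x ∈ Finset.range m := fun x hx => Finset.mem_range.2 (hw x hx)
  rw [← Finset.sum_fiberwise_of_maps_to hmaps (fun x => f x * G (w x))]
  refine (Finset.abs_sum_le_sum_abs _ _).trans (Finset.sum_le_sum fun j _ => ?_)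
  rw [← abs_mul, Finset.sum_mul]
  refine (congrArg abs (Finset.sum_congr rfl fun x hx => ?_)).le
  rw [(Finset.mem_filter.1 hx).2]

/-- Cauchy–Schwarz against an indicator:
`(∑_j |a_j| · 𝟙_c(j))² ≤ (∑_j a_j²) · #{j ∈ s : c j}`. -/
theorem sliceCrit_sum_mul_indicator_sq_le {ι : Type*} (s : Finset ι) (a : ι → ℝ)
    (c : ι → Prop) [DecidablePred c] :
    (∑ j ∈ s, |a j| * (if c j then 1 else 0)) ^ 2
      ≤ (∑ j ∈ s, a j ^ 2) * ((s.filter c).card : ℝ) := by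
  calc (∑ j ∈ s, |a j| * (if c j then 1 else 0)) ^ 2
      ≤ (∑ j ∈ s, |a j| ^ 2) * ∑ j ∈ s, (if c j then (1 : ℝ) else 0) ^ 2 :=
        Finset.sum_mul_sq_le_sq_mul_sq s _ _
    _ = (∑ j ∈ s, a j ^ 2) * ((s.filter c).card : ℝ) := by
        rw [Finset.natCast_card_filter]
        congr 1
        · exact Finset.sum_congr rfl fun j _ => sq_abs _
        · exact Finset.sum_congr rfl fun j _ => by split_ifs <;> norm_num

/-- The central window `{j ≤ n : |j − n/2| < t}` (written over `ℕ` as `n < 2j + 2t ∧ 2j < n + 2t`)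
has at most `4t` elements. -/
theorem sliceCrit_card_central_le (n t : ℕ) :
    ((Finset.range (n + 1)).filter (fun j => n < 2 * j + 2 * t ∧ 2 * j < n + 2 * t)).card
      ≤ 4 * t := by
  calc ((Finset.range (n + 1)).filter (fun j => n < 2 * j + 2 * t ∧ 2 * j < n + 2 * t)).card
      ≤ (Finset.Ico (n + 1 - 2 * t) (n + 2 * t)).card := by
        refine Finset.card_le_card_of_injOn (fun j => 2 * j) (fun j hj => ?_) ?_
        · simp only [Finset.coe_filter, Finset.mem_range, Set.mem_setOf_eq] at hj
          simp only [Finset.coe_Ico, Set.mem_Ico]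
          omega
        · intro a _ b _ h
          simp only at h
          omega
    _ ≤ 4 * t := by
        rw [Nat.card_Ico]
        omega

/-- Outside the central window the weight is far from `n/2`:
`¬(n < 2j + 2t ∧ 2j < n + 2t) → t ≤ |j − n/2|`. -/
theorem sliceCrit_far_of_not_central {n t j : ℕ}
    (h : ¬ (n < 2 * j + 2 * t ∧ 2 * j < n + 2 * t)) : (t : ℝ) ≤ |(j : ℝ) - n / 2| := by
  rw [not_and_or, not_lt, not_lt] at h
  rcases h with h | h
  · have h' : ((2 * j + 2 * t : ℕ) : ℝ) ≤ n := by exact_mod_cast h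
    push_cast at h'
    rw [le_abs]
    right
    linarith
  · have h' : ((n + 2 * t : ℕ) : ℝ) ≤ ((2 * j : ℕ) : ℝ) := by exact_mod_cast h
    push_cast at h'
    rw [le_abs]
    left
    linarith

/-- The slice criterion for one `n`, in abstract form: if `|f| ≤ 1`, `|G| ≤ 1`, the weight `w` maps
`s` into `range m`, the slice sums `A_j = ∑_{x : w x = j} f(x)` satisfy `∑_j A_j² ≤ B`, the window
`c` has at most `K` elements in `range m` and at most `T` points of `s` have weight outside `c`,
then `|∑_x f(x) G(w x)| ≤ √(K B) + T`. -/
theorem sliceCrit_abstract {α : Type*} (s : Finset α) (w : α → ℕ) (f : α → ℝ)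
    (hf : ∀ x, |f x| ≤ 1) {m : ℕ} (hw : ∀ x ∈ s, w x < m) (G : ℕ → ℝ) (hG : ∀ j, |G j| ≤ 1)
    (c : ℕ → Prop) [DecidablePred c] {B K T : ℝ}
    (hB : ∑ j ∈ Finset.range m, (∑ x ∈ s.filter (fun x => w x = j), f x) ^ 2 ≤ B)
    (hK : (((Finset.range m).filter c).card : ℝ) ≤ K)
    (hT : (((s.filter fun x => ¬ c (w x)).card : ℕ) : ℝ) ≤ T) :
    |∑ x ∈ s, f x * G (w x)| ≤ Real.sqrt (K * B) + T := by
  have hsplit : ∑ x ∈ s, f x * G (w x)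
      = ∑ x ∈ s, f x * (if c (w x) then G (w x) else 0)
        + ∑ x ∈ s, f x * (if c (w x) then 0 else G (w x)) := by
    rw [← Finset.sum_add_distrib]
    refine Finset.sum_congr rfl fun x _ => ?_
    rw [← mul_add]
    congr 1
    split_ifs <;> simp
  rw [hsplit]
  refine (abs_add_le _ _).trans (add_le_add ?_ ?_)
  · -- the central part: fibre decomposition and Cauchy–Schwarz
    have h1 := sliceCrit_abs_sum_mul_le s w f (fun j => if c j then G j else 0) hw
    refine h1.trans ?_
    have h2 : ∑ j ∈ Finset.range m,
          |∑ x ∈ s.filter (fun x => w x = j), f x| * |(if c j then G j else 0)|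
        ≤ ∑ j ∈ Finset.range m,
          |∑ x ∈ s.filter (fun x => w x = j), f x| * (if c j then 1 else 0) :=
      Finset.sum_le_sum fun j _ =>
        mul_le_mul_of_nonneg_left (by split_ifs <;> simp [hG]) (abs_nonneg _)
    refine h2.trans ((le_abs_self _).trans (Real.abs_le_sqrt ?_))
    calc (∑ j ∈ Finset.range m,
          |∑ x ∈ s.filter (fun x => w x = j), f x| * (if c j then 1 else 0)) ^ 2
        ≤ (∑ j ∈ Finset.range m, (∑ x ∈ s.filter (fun x => w x = j), f x) ^ 2)
            * (((Finset.range m).filter c).card : ℝ) :=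
          sliceCrit_sum_mul_indicator_sq_le (Finset.range m)
            (fun j => ∑ x ∈ s.filter (fun x => w x = j), f x) c
      _ ≤ B * K :=
          mul_le_mul hB hK (by positivity)
            ((Finset.sum_nonneg fun _ _ => sq_nonneg _).trans hB)
      _ = K * B := mul_comm _ _
  · -- the far part: at most `T` nonzero terms, each of absolute value `≤ 1`
    calc |∑ x ∈ s, f x * (if c (w x) then 0 else G (w x))|
        ≤ ∑ x ∈ s, |f x * (if c (w x) then 0 else G (w x))| := Finset.abs_sum_le_sum_abs _ _
      _ ≤ ∑ x ∈ s, (if ¬ c (w x) then (1 : ℝ) else 0) := by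
          refine Finset.sum_le_sum fun x _ => ?_
          by_cases hx : c (w x)
          · simp [hx]
          · rw [if_neg hx, if_pos hx, abs_mul]
            calc |f x| * |G (w x)| ≤ 1 * 1 := mul_le_mul (hf x) (hG _) (abs_nonneg _) zero_le_one
              _ = 1 := one_mul 1
      _ = (((s.filter fun x => ¬ c (w x)).card : ℕ) : ℝ) := by
          rw [Finset.natCast_card_filter]
      _ ≤ T := hT

/-- The slice criterion, abstract asymptotic form: for finsets `s n`, weights `w n : α → ℕ` with
values `≤ n` on `s n`, `|f| ≤ 1`, nonnegative quantities `S n k` with the Parseval-type bound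
`∑_j A_{n,j}² ≤ (n+1)⁻¹ ∑_{k ≤ n} (S n k)²` and the tail bound
`#{x ∈ s n : t ≤ |w n x − n/2|} ≤ 2·2ⁿ e^{−2t²/n}`: for every `ε > 0`, eventually in `n`,
`(∀ k ≤ n, S n k ≤ 2ⁿ/n) → |∑_{x ∈ s n} f(x) G(w n x)| ≤ ε 2ⁿ` for all `G` with `|G| ≤ 1`. -/
theorem sliceCrit_eventually {α : Type*} (s : ℕ → Finset α) (w : ℕ → α → ℕ) (f : α → ℝ)
    (hf : ∀ x, |f x| ≤ 1) (hw : ∀ n, ∀ x ∈ s n, w n x < n + 1) (S : ℕ → ℕ → ℝ)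
    (hS0 : ∀ n k, 0 ≤ S n k)
    (hL2 : ∀ n : ℕ,
      ∑ j ∈ Finset.range (n + 1), (∑ x ∈ (s n).filter (fun x => w n x = j), f x) ^ 2
        ≤ (∑ k ∈ Finset.range (n + 1), S n k ^ 2) / (n + 1))
    (hTail : ∀ (n : ℕ) (t : ℝ), 0 ≤ t →
      ((((s n).filter fun x => t ≤ |(w n x : ℝ) - n / 2|).card : ℕ) : ℝ)
        ≤ 2 * 2 ^ n * Real.exp (-(2 * t ^ 2 / n))) :
    ∀ ε : ℝ, 0 < ε → ∀ᶠ n : ℕ in atTop,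
      (∀ k ∈ Finset.range (n + 1), S n k ≤ (2 : ℝ) ^ n / n) →
      ∀ G : ℕ → ℝ, (∀ j, |G j| ≤ 1) →
        |∑ x ∈ s n, f x * G (w n x)| ≤ ε * (2 : ℝ) ^ n := by
  intro ε hε
  have hε4 : 0 < 4 / ε := by positivity
  obtain ⟨L, hL0, hLlog⟩ : ∃ L : ℝ, 0 ≤ L ∧ Real.log (4 / ε) ≤ L :=
    ⟨max 0 (Real.log (4 / ε)), le_max_left _ _, le_max_right _ _⟩
  have hexpL : Real.exp (-L) ≤ ε / 4 := by
    have h := Real.exp_le_exp.2 (neg_le_neg hLlog)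
    rwa [Real.exp_neg (Real.log _), Real.exp_log hε4, inv_div] at h
  filter_upwards [eventually_ge_atTop 1, eventually_ge_atTop ⌈(8 * L + 32) / ε ^ 2⌉₊]
    with n hn1 hn8
  intro hS G hG
  have hn1' : (1 : ℝ) ≤ n := by exact_mod_cast hn1
  have hnpos : (0 : ℝ) < n := by linarith
  have hn8' : 8 * L + 32 ≤ ε ^ 2 * n := by
    have h := (Nat.ceil_le).1 hn8
    rw [div_le_iff₀ (by positivity)] at h
    linarith
  obtain ⟨t, ht_ge, ht_lt⟩ :
      ∃ t : ℕ, Real.sqrt (n * L / 2) ≤ t ∧ (t : ℝ) < Real.sqrt (n * L / 2) + 1 :=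
    ⟨⌈Real.sqrt (n * L / 2)⌉₊, Nat.le_ceil _, Nat.ceil_lt_add_one (Real.sqrt_nonneg _)⟩
  have ht_le : (t : ℝ) ≤ n * L / 2 + 2 := by
    have h2 : Real.sqrt (n * L / 2) ≤ n * L / 2 + 1 := by
      rw [Real.sqrt_le_left (by positivity)]
      nlinarith
    linarith
  have ht_sq : (n : ℝ) * L / 2 ≤ (t : ℝ) ^ 2 := by
    calc (n : ℝ) * L / 2 = Real.sqrt (n * L / 2) ^ 2 := (Real.sq_sqrt (by positivity)).symm
      _ ≤ (t : ℝ) ^ 2 := pow_le_pow_left₀ (Real.sqrt_nonneg _) ht_ge 2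
  have hexp : Real.exp (-(2 * (t : ℝ) ^ 2 / n)) ≤ ε / 4 := by
    refine le_trans (Real.exp_le_exp.2 ?_) hexpL
    rw [neg_le_neg_iff, le_div_iff₀ hnpos]
    linarith
  -- the Parseval input, combined with the assumed uniform smallness of the `S n k`
  have hB : ∑ j ∈ Finset.range (n + 1), (∑ x ∈ (s n).filter (fun x => w n x = j), f x) ^ 2
      ≤ ((2 : ℝ) ^ n / n) ^ 2 := by
    refine (hL2 n).trans ?_
    rw [div_le_iff₀ (by positivity)]
    calc ∑ k ∈ Finset.range (n + 1), S n k ^ 2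
        ≤ ∑ k ∈ Finset.range (n + 1), ((2 : ℝ) ^ n / n) ^ 2 :=
          Finset.sum_le_sum fun k hk => pow_le_pow_left₀ (hS0 n k) (hS k hk) 2
      _ = ((2 : ℝ) ^ n / n) ^ 2 * (n + 1) := by
          rw [Finset.sum_const, Finset.card_range, nsmul_eq_mul]
          push_cast
          ring
  -- the central window has at most `4t` elements
  have hK : (((Finset.range (n + 1)).filter
      fun j => n < 2 * j + 2 * t ∧ 2 * j < n + 2 * t).card : ℝ) ≤ 4 * t := by
    exact_mod_cast sliceCrit_card_central_le n t
  -- the tail input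
  have hT : ((((s n).filter fun x => ¬ (n < 2 * w n x + 2 * t ∧ 2 * w n x < n + 2 * t)).card : ℕ) : ℝ)
      ≤ 2 * 2 ^ n * Real.exp (-(2 * (t : ℝ) ^ 2 / n)) := by
    refine le_trans ?_ (hTail n t (Nat.cast_nonneg t))
    exact_mod_cast Finset.card_le_card fun x hx => by
      rw [Finset.mem_filter] at hx ⊢
      exact ⟨hx.1, sliceCrit_far_of_not_central hx.2⟩
  have key := sliceCrit_abstract (s n) (w n) f hf (hw n) G hG
    (fun j => n < 2 * j + 2 * t ∧ 2 * j < n + 2 * t) hB hK hT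
  refine key.trans ?_
  -- the final numerics: `√(4t) / n ≤ ε / 2` and `2 e^{-2t²/n} ≤ ε / 2`
  have hsq : Real.sqrt (4 * (t : ℝ) * ((2 : ℝ) ^ n / n) ^ 2) ≤ ε * n / 2 * ((2 : ℝ) ^ n / n) := by
    rw [Real.sqrt_mul (by positivity), Real.sqrt_sq (by positivity)]
    refine mul_le_mul_of_nonneg_right ?_ (by positivity)
    rw [Real.sqrt_le_left (by positivity)]
    have h := mul_le_mul_of_nonneg_right hn8' hnpos.le
    nlinarith
  have hfar : 2 * (2 : ℝ) ^ n * Real.exp (-(2 * (t : ℝ) ^ 2 / n)) ≤ 2 * 2 ^ n * (ε / 4) :=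
    mul_le_mul_of_nonneg_left hexp (by positivity)
  have hn0 : (n : ℝ) ≠ 0 := hnpos.ne'
  calc Real.sqrt (4 * (t : ℝ) * ((2 : ℝ) ^ n / n) ^ 2) + 2 * 2 ^ n * Real.exp (-(2 * (t : ℝ) ^ 2 / n))
      ≤ ε * n / 2 * ((2 : ℝ) ^ n / n) + 2 * 2 ^ n * (ε / 4) := add_le_add hsq hfar
    _ = ε * 2 ^ n := by
        field_simp
        ring

/-- **Slice criterion** (skeleton v8, rung `K3c`). Write `s₂(N)` for the number of `1`-digits among
the `n` low binary digits of `N`, `A_j := ∑_{N < 2ⁿ, s₂(N) = j} λ(N)` for the slice sums of the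
Liouville function and `S(θ) := ∑_{N < 2ⁿ} λ(N) e(θ s₂(N))` for the Gelfond sums. Assume the
discrete Parseval bound `∑_{j ≤ n} A_j² ≤ (n+1)⁻¹ ∑_{k ≤ n} |S(k/(n+1))|²` (`hL2`) and the Hoeffding
tail `#{N < 2ⁿ : t ≤ |s₂(N) − n/2|} ≤ 2·2ⁿ e^{−2t²/n}` (`hTail`). Then for every `ε > 0`, for all
large `n`: if all the `n + 1` values `|S(k/(n+1))|` are `≤ 2ⁿ/n`, then
`|∑_{N < 2ⁿ} λ(N) G(s₂(N))| ≤ ε 2ⁿ` for every `G : ℕ → ℝ` with `|G| ≤ 1`. -/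
theorem stub_sliceCriterion_of
    (hL2 : ∀ n : ℕ,
      ∑ j ∈ Finset.range (n + 1),
          (∑ N ∈ (Finset.range (2 ^ n)).filter
              (fun N => (Finset.univ.filter fun i : Fin n => Nat.testBit N i = true).card = j),
            ((ArithmeticFunction.liouville N : ℤ) : ℝ)) ^ 2
        ≤ (∑ k ∈ Finset.range (n + 1),
            ‖∑ N ∈ Finset.range (2 ^ n), ((ArithmeticFunction.liouville N : ℤ) : ℂ) *
            Complex.exp (((2 * Real.pi * ((k : ℝ) / (n + 1)) *
              ((Finset.univ.filter fun i : Fin n => Nat.testBit N i = true).card : ℝ) : ℝ) : ℂ) * Complex.I)‖ ^ 2) / (n + 1))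
    (hTail : ∀ (n : ℕ) (t : ℝ), 0 ≤ t →
      ((((Finset.range (2 ^ n)).filter fun N =>
          t ≤ |((Finset.univ.filter fun i : Fin n => Nat.testBit N i = true).card : ℝ) - n / 2|).card : ℕ) : ℝ)
        ≤ 2 * 2 ^ n * Real.exp (-(2 * t ^ 2 / n))) :
    ∀ ε : ℝ, 0 < ε → ∀ᶠ n : ℕ in atTop,
      (∀ k ∈ Finset.range (n + 1),
        ‖∑ N ∈ Finset.range (2 ^ n), ((ArithmeticFunction.liouville N : ℤ) : ℂ) *
            Complex.exp (((2 * Real.pi * ((k : ℝ) / (n + 1)) *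
              ((Finset.univ.filter fun i : Fin n => Nat.testBit N i = true).card : ℝ) : ℝ) : ℂ) * Complex.I)‖ ≤ (2 : ℝ) ^ n / n) →
      ∀ G : ℕ → ℝ, (∀ j, |G j| ≤ 1) →
        |∑ N ∈ Finset.range (2 ^ n), ((ArithmeticFunction.liouville N : ℤ) : ℝ) *
            G (Finset.univ.filter fun i : Fin n => Nat.testBit N i = true).card| ≤ ε * (2 : ℝ) ^ n := by
  have hw : ∀ n, ∀ N ∈ Finset.range (2 ^ n),
      (Finset.univ.filter fun i : Fin n => Nat.testBit N i = true).card < n + 1 :=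
    fun n N _ => Nat.lt_succ_of_le ((Finset.card_filter_le _ _).trans (by simp))
  exact sliceCrit_eventually (fun n => Finset.range (2 ^ n))
    (fun n N => (Finset.univ.filter fun i : Fin n => Nat.testBit N i = true).card)
    (fun N => ((ArithmeticFunction.liouville N : ℤ) : ℝ))
    Literature.NumberTheory.LFunctions.LiouvilleSum.abs_liouville_le_one hw
    (fun n k => ‖∑ N ∈ Finset.range (2 ^ n), ((ArithmeticFunction.liouville N : ℤ) : ℂ) *
      Complex.exp (((2 * Real.pi * ((k : ℝ) / (n + 1)) *
        ((Finset.univ.filter fun i : Fin n => Nat.testBit N i = true).card : ℝ) : ℝ) : ℂ) *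
          Complex.I)‖)
    (fun _ _ => norm_nonneg _) hL2 hTail

end Summit.QuantumAdvantage.QuantumAdvantage.Theorems.LiouvilleOrthogonalTC0
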